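import Summits.CriticalPhenomena.Ising3DConformalLimit.Theses.AnomalousForcesInteraction

/-!
# `AnomalousForcesInteraction.CruxesGiveTarget` — the glue from the four ranked items to the route target

Route `route-CriticalPhenomena-AnomalousForcesInteraction`, item `stmt-CriticalPhenomena-14360`.

THEOREM-ONLY file (no definitions, no named facts). The route target `Target` is, verbatim, the
conjunction `EtaPositive ∧ GaussianLimitIsFree ∧ DeltaLowerBound ∧ MoebiusLimit` with the four
definientia inlined. The support item `CruxesGiveTarget` asks for the implication
`EtaPositive → GaussianLimitIsFree → (DeltaLowerBound, written out) → MoebiusLimit → Target`,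
which is pure logic: the four hypotheses are definitionally the four conjuncts, so the proof is
the anonymous constructor. No mathematics is involved.
-/

namespace Summit.CriticalPhenomena.Ising3DConformalLimit.Theorems

open Summit.CriticalPhenomena.Ising3DConformalLimit.Theses

/-- **Glue item `stmt-CriticalPhenomena-14360`.** The four ranked items of the route
`AnomalousForcesInteraction` — (AP) `EtaPositive`, (GF) `GaussianLimitIsFree`,
(DL) `DeltaLowerBound` (its definiens, written out verbatim in the item) and (ML) `MoebiusLimit` —
give the route target `Target`, which is by definition the conjunction (AP) ∧ (GF) ∧ (DL) ∧ (ML)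
of their definientia. Pure logic (anonymous constructor). -/
theorem anomalousForces_cruxesGiveTarget_proof : AnomalousForcesInteraction.CruxesGiveTarget := by
  unfold AnomalousForcesInteraction.CruxesGiveTarget
  intro hAP hGF hDL hML
  exact ⟨hAP, hGF, hDL, hML⟩

end Summit.CriticalPhenomena.Ising3DConformalLimit.Theorems
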